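import Summits.Ventures.HodgeRepro2.T5DatumAssembly

/-!
# T5SimilitudeConjugation — a similitude conjugates U(W_A) onto U(W_B) and T_A onto T_B

Kernel witness (seat p3, Tier-5 support) behind row N2.2.11 of route/T5-N2-route-3.md:
«g ∈ GU(W_A)(F⁺) conjugates T_A onto T_B», in the model E × E of the datum (files 53 / 59:
`T5DatumSimilitude.pairForm`, `T5DatumSimilitude.g0`).

* `autConj g` — conjugation of linear automorphisms along a linear isomorphism `g : V ≃ W`,
  `f ↦ g ∘ f ∘ g⁻¹`, as a group isomorphism `(V ≃ₗ V) ≃* (W ≃ₗ W)` (= `MulAut.conj g` when `V = W`).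
* `unitaryGroupOf B` — the isometry group of a form `B : V → V → E` inside `V ≃ₗ[E] V`.
* `IsSimilitude B B' g c` — `B' (g v) (g w) = c * B v w`.
* `map_unitaryGroupOf` / `unitaryEquiv` — a similitude of non-zero multiplier carries
  `unitaryGroupOf B` onto `unitaryGroupOf B'` (group isomorphism by conjugation).
* `diagAut` / `torus B` — the automorphisms of `E × E` preserving both coordinate lines, and the
  torus `T = diagAut ⊓ U(B)` of a block-diagonal form; `map_torus` — a diagonal similitude carries
  `torus B` onto `torus B'`.
* `map_torus_datum` / `exists_conj_torus_datum` — the instance of the record: `g0 u` (multiplier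
  `u⁻¹`, file 59's conjunct (7)) carries `torus (pairForm e₁ e₂)` onto
  `torus (pairForm (u e₁) (u⁻¹ e₂))`, assembled with `T5DatumAssembly.lemma_N2_complete`.

Prose that stays prose (labels unchanged): that the record's T_A(F⁺)\T_A(𝔸) is the compact group
of file 54 and that W_B ≅ W_A (Landherr) — nothing here identifies the two spaces isometrically;
`g0` is a similitude, not an isometry, and the unitary groups are conjugate inside GL(E × E).

Header declaration (README §8(d)): uses an L-value-free non-vanishing device: **no**.
-/

namespace Summit.Ventures.HodgeRepro2.T5SimilitudeConjugation

open LinearEquiv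

section General

variable {E : Type*} [Field E] {V W : Type*} [AddCommGroup V] [Module E V]
  [AddCommGroup W] [Module E W]

/-- Conjugation of linear automorphisms along a linear isomorphism `g : V ≃ W`:
`f ↦ g ∘ f ∘ g⁻¹`, a group isomorphism `(V ≃ₗ[E] V) ≃* (W ≃ₗ[E] W)`. -/
def autConj (g : V ≃ₗ[E] W) : (V ≃ₗ[E] V) ≃* (W ≃ₗ[E] W) where
  toFun f := g.symm.trans (f.trans g)
  invFun f := g.trans (f.trans g.symm)
  left_inv f := by ext x; simp
  right_inv f := by ext x; simp
  map_mul' f₁ f₂ := by ext x; simp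

/-- `autConj g f w = g (f (g⁻¹ w))`. -/
@[simp] theorem autConj_apply (g : V ≃ₗ[E] W) (f : V ≃ₗ[E] V) (w : W) :
    autConj g f w = g (f (g.symm w)) := rfl

/-- `(autConj g).symm f' v = g⁻¹ (f' (g v))`. -/
@[simp] theorem autConj_symm_apply (g : V ≃ₗ[E] W) (f : W ≃ₗ[E] W) (v : V) :
    (autConj g).symm f v = g.symm (f (g v)) := rfl

/-- For an automorphism `g` of `V`, `autConj g` is the inner automorphism `f ↦ g * f * g⁻¹`. -/
theorem autConj_eq_mul (g f : V ≃ₗ[E] V) : autConj g f = g * f * g⁻¹ := by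
  ext x; simp

/-- `autConj g = MulAut.conj g` for an automorphism `g` of `V`. -/
theorem autConj_eq_conj (g : V ≃ₗ[E] V) : autConj g = MulAut.conj g := by
  ext f x
  simp [MulAut.conj_apply]

/-- The isometry group of a form `B : V → V → E` inside the linear automorphism group of `V`:
the automorphisms `f` with `B (f v) (f w) = B v w` for all `v w`. -/
def unitaryGroupOf (B : V → V → E) : Subgroup (V ≃ₗ[E] V) where
  carrier := {f | ∀ v w, B (f v) (f w) = B v w}
  one_mem' := by intro v w; simp
  mul_mem' := by
    intro f₁ f₂ h₁ h₂ v w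
    simp only [Set.mem_setOf_eq] at h₁ h₂
    rw [mul_apply, mul_apply, h₁, h₂]
  inv_mem' := by
    intro f h v w
    simp only [Set.mem_setOf_eq] at h
    rw [coe_inv]
    calc B (f.symm v) (f.symm w) = B (f (f.symm v)) (f (f.symm w)) := (h _ _).symm
      _ = B v w := by simp

/-- Membership in `unitaryGroupOf B`. -/
theorem mem_unitaryGroupOf_iff (B : V → V → E) (f : V ≃ₗ[E] V) :
    f ∈ unitaryGroupOf B ↔ ∀ v w, B (f v) (f w) = B v w := Iff.rfl

/-- `g : V ≃ W` is a similitude of multiplier `c` from `B` to `B'`: `B' (g v) (g w) = c * B v w`. -/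
def IsSimilitude (B : V → V → E) (B' : W → W → E) (g : V ≃ₗ[E] W) (c : E) : Prop :=
  ∀ v w, B' (g v) (g w) = c * B v w

/-- An isometry is a similitude of multiplier `1`. -/
theorem isSimilitude_one_of_mem {B : V → V → E} {f : V ≃ₗ[E] V} (hf : f ∈ unitaryGroupOf B) :
    IsSimilitude B B f 1 := fun v w => by rw [one_mul]; exact hf v w

/-- Conjugation along a similitude of non-zero multiplier preserves the isometry groups:
`g f g⁻¹ ∈ U(B')` iff `f ∈ U(B)`. -/
theorem autConj_mem_unitaryGroupOf_iff {B : V → V → E} {B' : W → W → E} {g : V ≃ₗ[E] W} {c : E}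
    (hg : IsSimilitude B B' g c) (hc : c ≠ 0) (f : V ≃ₗ[E] V) :
    autConj g f ∈ unitaryGroupOf B' ↔ f ∈ unitaryGroupOf B := by
  constructor
  · intro h v w
    have h1 : B' (g (f v)) (g (f w)) = B' (g v) (g w) := by
      have := h (g v) (g w)
      simpa using this
    rw [hg, hg] at h1
    exact mul_left_cancel₀ hc h1
  · intro h v w
    simp only [autConj_apply]
    rw [hg, h, ← hg]
    simp

/-- The image of `U(B)` under conjugation along a similitude of non-zero multiplier is `U(B')`. -/
theorem map_unitaryGroupOf {B : V → V → E} {B' : W → W → E} {g : V ≃ₗ[E] W} {c : E}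
    (hg : IsSimilitude B B' g c) (hc : c ≠ 0) :
    (unitaryGroupOf B).map (autConj g).toMonoidHom = unitaryGroupOf B' := by
  ext f'
  rw [Subgroup.mem_map_equiv, ← autConj_mem_unitaryGroupOf_iff hg hc, MulEquiv.apply_symm_apply]

/-- The group isomorphism `U(B) ≃* U(B')` induced by a similitude of non-zero multiplier. -/
noncomputable def unitaryEquiv {B : V → V → E} {B' : W → W → E} {g : V ≃ₗ[E] W} {c : E}
    (hg : IsSimilitude B B' g c) (hc : c ≠ 0) : unitaryGroupOf B ≃* unitaryGroupOf B' :=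
  ((autConj g).subgroupMap (unitaryGroupOf B)).trans
    (MulEquiv.subgroupCongr (map_unitaryGroupOf hg hc))

/-- `unitaryEquiv` acts by `f ↦ g ∘ f ∘ g⁻¹`. -/
theorem coe_unitaryEquiv_apply {B : V → V → E} {B' : W → W → E} {g : V ≃ₗ[E] W} {c : E}
    (hg : IsSimilitude B B' g c) (hc : c ≠ 0) (f : unitaryGroupOf B) :
    (unitaryEquiv hg hc f : W ≃ₗ[E] W) = autConj g f := rfl

/-- A subgroup containing `g` is carried onto itself by conjugation along `g`. -/
theorem map_autConj_self_of_mem (H : Subgroup (V ≃ₗ[E] V)) {g : V ≃ₗ[E] V} (hg : g ∈ H) :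
    H.map (autConj g).toMonoidHom = H := by
  ext f
  rw [Subgroup.mem_map_equiv]
  constructor
  · intro h
    have : f = autConj g ((autConj g).symm f) := (MulEquiv.apply_symm_apply _ _).symm
    rw [this, autConj_eq_mul]
    exact H.mul_mem (H.mul_mem hg h) (H.inv_mem hg)
  · intro h
    have : (autConj g).symm f = g⁻¹ * f * g := by
      ext x; simp
    rw [this]
    exact H.mul_mem (H.mul_mem (H.inv_mem hg) h) hg

end General

section Torus

variable {E : Type*} [Field E]

/-- An automorphism of `E × E` preserving both coordinate lines `E × 0` and `0 × E`. -/
def IsDiagAut (f : (E × E) ≃ₗ[E] (E × E)) : Prop :=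
  (∀ x : E, (f (x, 0)).2 = 0) ∧ (∀ y : E, (f (0, y)).1 = 0)

/-- A diagonal automorphism maps `(x, 0)` into the first line. -/
theorem IsDiagAut.apply_fst {f : (E × E) ≃ₗ[E] (E × E)} (hf : IsDiagAut f) (x : E) :
    f (x, 0) = ((f (x, 0)).1, 0) := Prod.ext rfl (hf.1 x)

/-- A diagonal automorphism maps `(0, y)` into the second line. -/
theorem IsDiagAut.apply_snd {f : (E × E) ≃ₗ[E] (E × E)} (hf : IsDiagAut f) (y : E) :
    f (0, y) = (0, (f (0, y)).2) := Prod.ext (hf.2 y) rfl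

/-- The identity is diagonal. -/
theorem isDiagAut_one : IsDiagAut (1 : (E × E) ≃ₗ[E] (E × E)) := ⟨fun _ => rfl, fun _ => rfl⟩

/-- Diagonal automorphisms are closed under composition. -/
theorem IsDiagAut.mul {f g : (E × E) ≃ₗ[E] (E × E)} (hf : IsDiagAut f) (hg : IsDiagAut g) :
    IsDiagAut (f * g) :=
  ⟨fun x => by rw [mul_apply, hg.apply_fst x]; exact hf.1 _,
   fun y => by rw [mul_apply, hg.apply_snd y]; exact hf.2 _⟩

/-- The inverse of a diagonal automorphism is diagonal. -/
theorem IsDiagAut.inv {f : (E × E) ≃ₗ[E] (E × E)} (hf : IsDiagAut f) : IsDiagAut f⁻¹ := by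
  refine ⟨fun x => ?_, fun y => ?_⟩
  · rw [coe_inv]
    set a := (f.symm (x, 0)).1 with ha
    set b := (f.symm (x, 0)).2 with hb
    have h1 : f (f.symm (x, 0)) = (x, 0) := f.apply_symm_apply _
    have h2 : f.symm (x, 0) = (a, 0) + (0, b) := by ext <;> simp [ha, hb]
    rw [h2, map_add, hf.apply_fst, hf.apply_snd] at h1
    have h3 : (f (0, b)).2 = 0 := by simpa using congrArg Prod.snd h1
    have h4 : f (0, b) = 0 := Prod.ext (hf.2 b) h3
    have h5 : ((0 : E), b) = 0 := f.injective (h4.trans f.map_zero.symm)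
    simpa using congrArg Prod.snd h5
  · rw [coe_inv]
    set a := (f.symm (0, y)).1 with ha
    set b := (f.symm (0, y)).2 with hb
    have h1 : f (f.symm (0, y)) = (0, y) := f.apply_symm_apply _
    have h2 : f.symm (0, y) = (a, 0) + (0, b) := by ext <;> simp [ha, hb]
    rw [h2, map_add, hf.apply_fst, hf.apply_snd] at h1
    have h3 : (f (a, 0)).1 = 0 := by simpa using congrArg Prod.fst h1
    have h4 : f (a, 0) = 0 := Prod.ext h3 (hf.1 a)
    have h5 : (a, (0 : E)) = 0 := f.injective (h4.trans f.map_zero.symm)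
    simpa using congrArg Prod.fst h5

/-- The subgroup of diagonal automorphisms of `E × E` (the automorphisms preserving both lines). -/
def diagAut : Subgroup ((E × E) ≃ₗ[E] (E × E)) where
  carrier := {f | IsDiagAut f}
  one_mem' := isDiagAut_one
  mul_mem' hf hg := hf.mul hg
  inv_mem' hf := hf.inv

/-- Membership in `diagAut`. -/
theorem mem_diagAut_iff (f : (E × E) ≃ₗ[E] (E × E)) : f ∈ diagAut ↔ IsDiagAut f := Iff.rfl

/-- The torus of a form `B` on `E × E`: the diagonal isometries `T = diagAut ⊓ U(B)`. -/
def torus (B : E × E → E × E → E) : Subgroup ((E × E) ≃ₗ[E] (E × E)) :=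
  diagAut ⊓ unitaryGroupOf B

/-- Membership in the torus. -/
theorem mem_torus_iff (B : E × E → E × E → E) (f : (E × E) ≃ₗ[E] (E × E)) :
    f ∈ torus B ↔ IsDiagAut f ∧ ∀ v w, B (f v) (f w) = B v w := Iff.rfl

/-- Conjugation along a diagonal automorphism carries `diagAut` onto itself. -/
theorem map_diagAut {g : (E × E) ≃ₗ[E] (E × E)} (hg : IsDiagAut g) :
    (diagAut (E := E)).map (autConj g).toMonoidHom = diagAut := by
  have h := map_autConj_self_of_mem (diagAut (E := E)) (g := g) ((mem_diagAut_iff g).2 hg)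
  exact h

/-- ROW N2.2.11, abstract form: a DIAGONAL similitude `g` of non-zero multiplier carries the torus
of `B` onto the torus of `B'` (and `U(B)` onto `U(B')`) by conjugation. -/
theorem map_torus {B B' : E × E → E × E → E} {g : (E × E) ≃ₗ[E] (E × E)} {c : E}
    (hg : IsSimilitude B B' g c) (hc : c ≠ 0) (hd : IsDiagAut g) :
    (torus B).map (autConj g).toMonoidHom = torus B' := by
  unfold torus
  rw [Subgroup.map_inf _ _ _ (autConj g).injective, map_diagAut hd, map_unitaryGroupOf hg hc]

/-- The group isomorphism `T_B ≃* T_B'` induced by a diagonal similitude. -/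
noncomputable def torusEquiv {B B' : E × E → E × E → E} {g : (E × E) ≃ₗ[E] (E × E)} {c : E}
    (hg : IsSimilitude B B' g c) (hc : c ≠ 0) (hd : IsDiagAut g) : torus B ≃* torus B' :=
  ((autConj g).subgroupMap (torus B)).trans (MulEquiv.subgroupCongr (map_torus hg hc hd))

end Torus

section Datum

variable {E : Type*} [Field E]

open T5DatumSimilitude

/-- The record's `g0 u = (u⁻¹ ·, ·)` as a linear automorphism of `E × E` (`u ≠ 0`). -/
noncomputable def g0Equiv (u : E) (hu : u ≠ 0) : (E × E) ≃ₗ[E] (E × E) :=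
  (smulOfNeZero E E u⁻¹ (inv_ne_zero hu)).prodCongr (refl E E)

/-- `g0Equiv u hu` is the function `g0 u` of file 53. -/
@[simp] theorem g0Equiv_apply (u : E) (hu : u ≠ 0) (v : E × E) : g0Equiv u hu v = g0 u v := by
  simp [g0Equiv, g0, smul_eq_mul]

/-- `g0 u` is diagonal. -/
theorem isDiagAut_g0Equiv (u : E) (hu : u ≠ 0) : IsDiagAut (g0Equiv u hu) :=
  ⟨fun x => by simp [g0], fun y => by simp [g0]⟩

/-- The similitude identity of file 59 (conjunct (7) of `lemma_N2_complete`) says exactly that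
`g0 u` is a similitude of multiplier `u⁻¹` from `W_A = pairForm e₁ e₂` to
`W_B = pairForm (u e₁) (u⁻¹ e₂)`. -/
theorem isSimilitude_g0Equiv [StarRing E] {u e₁ e₂ : E} (hu : u ≠ 0)
    (h : ∀ v w, pairForm (u * e₁) (u⁻¹ * e₂) (g0 u v) (g0 u w) = u⁻¹ * pairForm e₁ e₂ v w) :
    IsSimilitude (pairForm e₁ e₂) (pairForm (u * e₁) (u⁻¹ * e₂)) (g0Equiv u hu) u⁻¹ :=
  fun v w => by rw [g0Equiv_apply, g0Equiv_apply]; exact h v w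

/-- ROW N2.2.11 for the datum: conjugation by `g0 u` carries `U(W_A)` onto `U(W_B)`. -/
theorem map_unitaryGroupOf_datum [StarRing E] {u e₁ e₂ : E} (hu : u ≠ 0)
    (h : ∀ v w, pairForm (u * e₁) (u⁻¹ * e₂) (g0 u v) (g0 u w) = u⁻¹ * pairForm e₁ e₂ v w) :
    (unitaryGroupOf (pairForm e₁ e₂)).map (autConj (g0Equiv u hu)).toMonoidHom =
      unitaryGroupOf (pairForm (u * e₁) (u⁻¹ * e₂)) :=
  map_unitaryGroupOf (isSimilitude_g0Equiv hu h) (inv_ne_zero hu)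

/-- ROW N2.2.11 for the datum: conjugation by `g0 u` carries `T_A` onto `T_B`. -/
theorem map_torus_datum [StarRing E] {u e₁ e₂ : E} (hu : u ≠ 0)
    (h : ∀ v w, pairForm (u * e₁) (u⁻¹ * e₂) (g0 u v) (g0 u w) = u⁻¹ * pairForm e₁ e₂ v w) :
    (torus (pairForm e₁ e₂)).map (autConj (g0Equiv u hu)).toMonoidHom =
      torus (pairForm (u * e₁) (u⁻¹ * e₂)) :=
  map_torus (isSimilitude_g0Equiv hu h) (inv_ne_zero hu) (isDiagAut_g0Equiv u hu)

end Datum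

section Assembled

open T5DatumSimilitude T5CubeTypes

variable {K : Type*} [Field K] [NumberField K] [NumberField.IsCMField K]

/-- LEMMA N.2 + ROW N2.2.11 assembled on the CM field: for a CM frame `τ` and admissible
`e₁₁₁`, `e₁₀₀` there is a totally real `u ≠ 0` (the `u` of `lemma_N2_complete`, with all of its
properties) such that conjugation by `g0 u` carries `U(W_A)` onto `U(W_B)` and `T_A` onto `T_B`
for `W_A = pairForm e₁₁₁ e₁₀₀` and `W_B = pairForm (u e₁₁₁) (u⁻¹ e₁₀₀)`. -/
theorem exists_conj_torus_datum {τ : Fin 3 → K →+* ℂ} (hτ : IsCMFrame τ) {e₁ e₂ : K}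
    (h₁ : IsLiuSignElement K (cubeType τ t111) e₁) (h₂ : IsLiuSignElement K (cubeType τ t100) e₂) :
    ∃ u : K, ∃ hu : u ≠ 0, star u = u ∧
      IsLiuSignElement K (cubeType τ t101) (u * e₁) ∧
      IsLiuSignElement K (cubeType τ t110) (u⁻¹ * e₂) ∧
      (∀ φ : K →+* ℂ, (φ u).re < 0 ↔ φ = τ 1 ∨ φ = NumberField.ComplexEmbedding.conjugate (τ 1)) ∧
      (unitaryGroupOf (pairForm e₁ e₂)).map (autConj (g0Equiv u hu)).toMonoidHom =
        unitaryGroupOf (pairForm (u * e₁) (u⁻¹ * e₂)) ∧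
      (torus (pairForm e₁ e₂)).map (autConj (g0Equiv u hu)).toMonoidHom =
        torus (pairForm (u * e₁) (u⁻¹ * e₂)) := by
  obtain ⟨u, hstar, hu, h101, h110, -, hsign, hsim, -, -, -, -⟩ :=
    T5DatumAssembly.lemma_N2_complete hτ h₁ h₂
  exact ⟨u, hu, hstar, h101, h110, hsign, map_unitaryGroupOf_datum hu hsim,
    map_torus_datum hu hsim⟩

end Assembled

end Summit.Ventures.HodgeRepro2.T5SimilitudeConjugation
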